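import Literature.Barriers.RiemannHypothesis.TuranPartialSums
import Literature.NumberTheory.LFunctions.MontgomeryVaughanLogMeans
import Mathlib.NumberTheory.AbelSummation
import Mathlib.NumberTheory.LSeries.Dirichlet
import Mathlib.NumberTheory.EulerProduct.DirichletLSeries
import Mathlib.Analysis.SpecialFunctions.Pow.Deriv
import HarnessLib

/-!
# Montgomery–Vaughan's Theorem 3 ⇒ the zero-free half-plane `σ ≥ 1 + (4/π − 1) log log N/log N` for the sections `ζ_N` (Theorem 4)

Barrier catalogue `Literature/Barriers/RiemannHypothesis/` (D-0021). Proofs only (no definitions, no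
named facts), companion of `TuranPartialSums.lean` (next to `TuranPartialSumsThmIVProofs.lean`, which
proves Turán's elementary zero-free half-plane `σ ≥ 1 + 2 log log N/log N`, and `TuranPartialSumsBohr.lean`,
Bohr's transfer with `Montgomery1983_theorem_of_twisted_zeros`), toward the discharge of the two-sided
named fact
`Literature.Barriers.RiemannHypothesis.montgomery1983_supZeroRe` (`ψ_N = 1 + (4/π − 1 + o(1))
log log N/log N`), which that file reduces to the two printed theorems
(`supZeroRe_of_montgomery_of_montgomeryVaughan`):

* lower half — `Montgomery1983_theorem` (Montgomery 1983, Theorem p. 497; named fact — reduced in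
  `TuranPartialSumsBohr.lean` to a zero of a twisted section, Montgomery's §4, still open);
* upper half — `MontgomeryVaughan2001_zeroFree` (Montgomery–Vaughan 2001, **Theorem 4**, p. 202:
  "There is a constant `N₀` such that if `N > N₀`, then `U_N(s) ≠ 0` whenever
  `σ ≥ 1 + (4/π − 1) log log N/log N`").

This file PROVES the source's deduction of Theorem 4 from its Theorem 3
(`Literature.NumberTheory.LFunctions.MontgomeryVaughan2001_thm3`, the named fact
`S₁(x) ≪ |F(σ)|(σ − 1)((σ − 1)^{-4/π} + log x)` of `MontgomeryVaughanLogMeans.lean`):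

> `MontgomeryVaughan2001_zeroFree_of_thm3 : MontgomeryVaughan2001_thm3 → MontgomeryVaughan2001_zeroFree`,

hence `supZeroRe_of_montgomery_of_thm3 : Montgomery1983_theorem → MontgomeryVaughan2001_thm3 →
montgomery1983_supZeroRe`. What remains for `montgomery1983_supZeroRe_holds` is Theorem 3 itself
(via the paper's Theorem 2 and Lemmas 1–2) and Montgomery's 1983 theorem.

## The argument (Montgomery–Vaughan 2001, §4, pp. 211–212), as formalised

"By integrating by parts we see that `Σ_{n>N} f(n)n^{-σ} = −S₁(N)N^{1−σ} + (σ−1)∫_N^∞ S₁(u)u^{-σ} du`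
for `σ > 1`. By (3) [Theorem 3] it follows that the above is `≪ |F(σ)|(σ−1)((σ−1)^{-4/π} + log N)
N^{1−σ}` when `1 + 1/log N ≤ σ ≤ 2`. Since `U_N(s) = ζ(s) − Σ_{n>N} n^{-s}`, by taking `f(n) = n^{-it}`
we deduce that `U_N(s) = ζ(s)(1 + O((log log N)^{1−4/π}))` uniformly for `σ ≥ 1 + (4/π − 1)
log log N/log N`. Since `ζ(s) ≠ 0` in this half-plane, it follows that `U_N(s) ≠ 0`."

* `f(n) = n^{-it}` is Mathlib's `riemannZetaSummandHom` at `s = it`, `t ≠ 0` (`twist_apply`);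
  `LSeries_twist`: `F(σ) = ζ(σ + it)`; `sum_Icc_zero_twist_div`: the cumulative sums of
  `c(k) = k^{-it}/k` are `S₁`; real `s` need no twist (`zetaPartialSum_ofReal_ne_zero`).
* `norm_zetaPartialSum_sub_le`: Abel summation (Mathlib's `sum_mul_eq_sub_sub_integral_mul'`) of the
  finite block `ζ_M(s) − ζ_N(s) = Σ_{N<k≤M} k^{1−σ} c(k)` with weight `g(u) = u^{1−σ}`, Theorem 3 at every
  real `x ≥ N` (valid as `1 + 1/log x ≤ 1 + 1/log N ≤ σ`), the primitive
  `u^{1−σ}((σ−1)^{-4/π} + log u + 1/(σ−1))` of `−(σ−1)u^{−σ}((σ−1)^{-4/π} + log u)`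
  (`hasDerivAt_tailPrimitive`, `integral_tail_eq`), and the monotonicity of `log u · u^{1−σ}` for
  `log u ≥ 1/(σ−1)` (`log_mul_rpow_le`), giving, uniformly in `M`,
  `|ζ_M(s) − ζ_N(s)| ≤ 4C|ζ(s)|((σ−1)^{1−4/π} + (σ−1) log N)N^{1−σ}`; `M → ∞`
  (`tendsto_zetaPartialSum`) gives the tail bound `norm_zeta_sub_zetaPartialSum_le`.
* `errorFactor_le`: for `σ − 1 ≥ κ log log N/log N`, `κ = 4/π − 1`, `κ log log N ≥ 1`, the factor is
  at most `E₀(N) = (κ log log N)^{−κ} + κ log log N (log N)^{−κ}` (both summands decrease in `σ`;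
  `mul_exp_neg_mul_le`), and `E₀(N) → 0` (`tendsto_errorBound`). With `N₀` such that
  `4C E₀(N) < 1`, `κ log log N ≥ 1` and `N ≥ 16` for `N > N₀`: a zero `s` of `ζ_N` with `σ < 2` in the
  half-plane would give `|ζ(s)| ≤ 4C E₀(N)|ζ(s)| < |ζ(s)|` (`ζ(s) ≠ 0`, `σ > 1`); for `σ ≥ 2`,
  `zetaPartialSum_ne_zero_of_two_le_re`; for real `s`, `ζ_N(σ) > 0`.

Axioms: `propext`, `Classical.choice`, `Quot.sound` only.

## References

* [MontgomeryVaughan2001] H. L. Montgomery, R. C. Vaughan, *Mean values of multiplicative functions*,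
  Period. Math. Hungar. 43 (2001), 199–214 (read: Theorem 4 p. 202 and its proof §4 pp. 211–212;
  Theorem 3 p. 201).
* [Montgomery1983] H. L. Montgomery, *Zeros of approximations to the zeta function*, Studies in Pure
  Mathematics (Turán memorial), Birkhäuser 1983, 497–506 (Theorem, p. 497).
-/

noncomputable section

open Complex Filter MeasureTheory Set
open scoped Topology

namespace Literature.Barriers.RiemannHypothesis

open Literature.NumberTheory.LFunctions Literature.NumberTheory.LFunctions.MontgomeryVaughan2001

/-! ## The twist `n ↦ n^{-it}` as a totally multiplicative function -/

/-- `(t : ℂ) · i ≠ 0` for real `t ≠ 0`. [folklore] -/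
theorem ofReal_mul_I_ne_zero {t : ℝ} (ht : t ≠ 0) : (t : ℂ) * I ≠ 0 :=
  mul_ne_zero (ofReal_ne_zero.2 ht) I_ne_zero

/-- Mathlib's `riemannZetaSummandHom` at `s = it` (`t ≠ 0`) is the totally multiplicative function
`n ↦ n^{-it}` (value `0` at `n = 0`), to which Theorem 3 is applied in §4 of the source ("by taking
`f(n) = n^{-it}`"); real `s` (`t = 0`) are treated directly (`zetaPartialSum_ofReal_ne_zero`).
[cite: MontgomeryVaughan2001, §4 (p. 212)] -/
theorem twist_apply {t : ℝ} (ht : t ≠ 0) (n : ℕ) :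
    riemannZetaSummandHom (ofReal_mul_I_ne_zero ht) n = (n : ℂ) ^ (-(t * I)) := rfl

/-- `|n^{-it}| ≤ 1` (indeed `= 1` for `n ≥ 1`, and `0` at `n = 0`). [folklore] -/
theorem norm_twist_le {t : ℝ} (ht : t ≠ 0) (n : ℕ) :
    ‖riemannZetaSummandHom (ofReal_mul_I_ne_zero ht) n‖ ≤ 1 := by
  rcases eq_or_ne n 0 with rfl | hn
  · simp
  rw [twist_apply ht, norm_natCast_cpow_of_pos (Nat.pos_of_ne_zero hn)]
  simp

/-- For real `σ` and `N ≥ 1`, `ζ_N(σ) = Σ_{n ≤ N} n^{-σ} > 0`; in particular `ζ_N(σ) ≠ 0`. [folklore] -/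
theorem zetaPartialSum_ofReal_ne_zero {N : ℕ} (hN : 1 ≤ N) (σ : ℝ) :
    zetaPartialSum N (σ : ℂ) ≠ 0 := by
  have hsum : zetaPartialSum N (σ : ℂ) = ((∑ n ∈ Finset.Icc 1 N, (n : ℝ) ^ (-σ) : ℝ) : ℂ) := by
    rw [zetaPartialSum, ofReal_sum]
    refine Finset.sum_congr rfl fun n hn ↦ ?_
    rw [ofReal_cpow (Nat.cast_nonneg n), ofReal_natCast, ofReal_neg]
  rw [hsum, ofReal_ne_zero]
  refine (Finset.sum_pos (fun n hn ↦ ?_) ⟨1, Finset.mem_Icc.2 ⟨le_rfl, hN⟩⟩).ne'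
  rw [Finset.mem_Icc] at hn
  exact Real.rpow_pos_of_pos (by exact_mod_cast hn.1) _

/-- `F(σ) = Σ n^{-it} n^{-σ} = ζ(σ + it)` for `σ > 1`. [cite: MontgomeryVaughan2001, §4 (p. 212)] -/
theorem LSeries_twist {σ : ℝ} (hσ : 1 < σ) {t : ℝ} (ht : t ≠ 0) :
    LSeries (riemannZetaSummandHom (ofReal_mul_I_ne_zero ht) ·) σ = riemannZeta (σ + t * I) := by
  have hre : 1 < ((σ : ℂ) + t * I).re := by simp [hσ]
  rw [zeta_eq_tsum_one_div_nat_cpow hre, LSeries]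
  congr 1
  ext n
  rcases eq_or_ne n 0 with rfl | hn
  · rw [LSeries.term_zero, Nat.cast_zero, zero_cpow, div_zero]
    intro h
    have := congrArg Complex.re h
    simp at this
    linarith
  rw [LSeries.term_of_ne_zero hn, twist_apply ht]
  have hn' : (n : ℂ) ≠ 0 := Nat.cast_ne_zero.2 hn
  rw [cpow_add _ _ hn', cpow_neg]
  field_simp

/-- `Σ_{k ≤ n} k^{-it}/k = S₁(n)` with the `k = 0` term vanishing: the cumulative sums in Abel's
formula are the logarithmic means of the source. [folklore] -/
theorem sum_Icc_zero_twist_div {t : ℝ} (ht : t ≠ 0) (n : ℕ) :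
    ∑ k ∈ Finset.Icc 0 n, riemannZetaSummandHom (ofReal_mul_I_ne_zero ht) k / k =
      S₁ (riemannZetaSummandHom (ofReal_mul_I_ne_zero ht) ·) n := by
  rw [S₁_natCast, Finset.Icc_eq_cons_Ioc (Nat.zero_le n), Finset.sum_cons,
    show Finset.Ioc 0 n = Finset.Icc 1 n from (Finset.Icc_add_one_left_eq_Ioc 0 n).symm]
  simp

/-- The summand of the tail: `k^{1−σ} · (k^{-it}/k) = k^{-(σ+it)}` for `k ≥ 1`. [folklore] -/
theorem rpow_mul_twist_div {k : ℕ} (hk : k ≠ 0) (σ : ℝ) {t : ℝ} (ht : t ≠ 0) :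
    (((k : ℝ) ^ (1 - σ) : ℝ) : ℂ) * (riemannZetaSummandHom (ofReal_mul_I_ne_zero ht) k / k) =
      (k : ℂ) ^ (-((σ : ℂ) + t * I)) := by
  have hk' : (k : ℂ) ≠ 0 := Nat.cast_ne_zero.2 hk
  have hk0 : (0 : ℝ) ≤ k := Nat.cast_nonneg k
  rw [twist_apply ht, ofReal_cpow hk0, ofReal_natCast]
  rw [show -((σ : ℂ) + t * I) = ((1 - σ : ℝ) : ℂ) + -(t * I) + (-1) by push_cast; ring]
  rw [cpow_add _ _ hk', cpow_add _ _ hk', cpow_neg_one]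
  ring

/-- The tail block of the zeta section as an Abel sum: for `N ≤ M`,
`ζ_M(s) − ζ_N(s) = Σ_{N < k ≤ M} k^{1−σ} (k^{-it}/k)`, `s = σ + it`. [folklore] -/
theorem zetaPartialSum_sub_eq_sum_Ioc {N M : ℕ} (hNM : N ≤ M) (σ : ℝ) {t : ℝ} (ht : t ≠ 0) :
    zetaPartialSum M (σ + t * I) - zetaPartialSum N (σ + t * I) =
      ∑ k ∈ Finset.Ioc N M, (((k : ℝ) ^ (1 - σ) : ℝ) : ℂ) *
        (riemannZetaSummandHom (ofReal_mul_I_ne_zero ht) k / k) := by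
  have hsplit : Finset.Icc 1 M = Finset.Icc 1 N ∪ Finset.Ioc N M := by
    ext k; simp only [Finset.mem_union, Finset.mem_Icc, Finset.mem_Ioc]; omega
  have hdisj : Disjoint (Finset.Icc 1 N) (Finset.Ioc N M) := by
    rw [Finset.disjoint_left]; intro k hk hk'
    simp only [Finset.mem_Icc, Finset.mem_Ioc] at hk hk'; omega
  rw [zetaPartialSum, zetaPartialSum, hsplit, Finset.sum_union hdisj, add_sub_cancel_left]
  refine Finset.sum_congr rfl fun k hk ↦ ?_
  rw [Finset.mem_Ioc] at hk
  rw [rpow_mul_twist_div (by omega) σ ht]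

/-- `ζ_M(s) → ζ(s)` as `M → ∞`, for `Re s > 1`. [folklore] -/
theorem tendsto_zetaPartialSum {s : ℂ} (hs : 1 < s.re) :
    Tendsto (fun M : ℕ ↦ zetaPartialSum M s) atTop (𝓝 (riemannZeta s)) := by
  have hsum : HasSum (fun n : ℕ ↦ 1 / (n : ℂ) ^ s) (riemannZeta s) := by
    rw [zeta_eq_tsum_one_div_nat_cpow hs]
    exact (Complex.summable_one_div_nat_cpow.2 hs).hasSum
  have h1 := hsum.tendsto_sum_nat
  have h2 : Tendsto (fun M : ℕ ↦ ∑ n ∈ Finset.range (M + 1), 1 / (n : ℂ) ^ s) atTop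
      (𝓝 (riemannZeta s)) := h1.comp (tendsto_add_atTop_nat 1)
  refine h2.congr fun M ↦ ?_
  rw [zetaPartialSum, Finset.range_eq_Ico, Finset.sum_eq_sum_Ico_succ_bot (Nat.succ_pos M),
    Nat.cast_zero, zero_cpow (by rintro rfl; norm_num at hs), div_zero, zero_add]
  rw [show Finset.Ico 1 (M + 1) = Finset.Icc 1 M from rfl]
  refine Finset.sum_congr rfl fun n _ ↦ ?_
  rw [cpow_neg, one_div]

/-! ## Two elementary monotonicity facts -/

/-- For `0 < N ≤ M` and `(σ − 1) log N ≥ 1` (`σ > 1`): `log M · M^{1−σ} ≤ log N · N^{1−σ}`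
(`u ↦ log u · u^{1−σ}` decreases once `log u ≥ 1/(σ − 1)`; here from `r^{σ−1} ≥ 1 + (σ−1) log r`,
`r = M/N`). [folklore] -/
theorem log_mul_rpow_le {σ N M : ℝ} (hσ : 1 < σ) (hN : 0 < N) (hNM : N ≤ M)
    (hlog : 1 ≤ (σ - 1) * Real.log N) :
    Real.log M * M ^ (1 - σ) ≤ Real.log N * N ^ (1 - σ) := by
  have hM : 0 < M := lt_of_lt_of_le hN hNM
  have hlogN : 0 < Real.log N := by
    by_contra h
    have : (σ - 1) * Real.log N ≤ 0 := mul_nonpos_of_nonneg_of_nonpos (by linarith) (not_lt.mp h)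
    linarith
  set r : ℝ := M / N with hr
  have hr1 : 1 ≤ r := by rw [hr, le_div_iff₀ hN]; linarith
  have hr0 : 0 < r := by linarith
  have hMr : M = N * r := by rw [hr]; field_simp
  have hlogr : 0 ≤ Real.log r := Real.log_nonneg hr1
  -- `log M ≤ log N · r^{σ-1}`
  have key : Real.log M ≤ Real.log N * r ^ (σ - 1) := by
    have h1 : 1 + (σ - 1) * Real.log r ≤ r ^ (σ - 1) := by
      rw [Real.rpow_def_of_pos hr0]
      have := Real.add_one_le_exp (Real.log r * (σ - 1))
      nlinarith
    have h2 : Real.log M = Real.log N + Real.log r := by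
      rw [hMr, Real.log_mul hN.ne' hr0.ne']
    rw [h2]
    have h3 : Real.log r ≤ Real.log N * ((σ - 1) * Real.log r) := by
      have : Real.log r * 1 ≤ Real.log r * ((σ - 1) * Real.log N) :=
        mul_le_mul_of_nonneg_left hlog hlogr
      linarith
    have h4 : Real.log N * (1 + (σ - 1) * Real.log r) ≤ Real.log N * r ^ (σ - 1) :=
      mul_le_mul_of_nonneg_left h1 hlogN.le
    linarith
  -- multiply by `M^{1-σ} = N^{1-σ} r^{1-σ}` and use `r^{σ-1} r^{1-σ} = 1`
  have hsplit : M ^ (1 - σ) = N ^ (1 - σ) * r ^ (1 - σ) := by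
    rw [hMr, Real.mul_rpow hN.le hr0.le]
  have hrr : r ^ (σ - 1) * r ^ (1 - σ) = 1 := by
    rw [← Real.rpow_add hr0, show σ - 1 + (1 - σ) = 0 by ring, Real.rpow_zero]
  have hMpow : 0 < M ^ (1 - σ) := Real.rpow_pos_of_pos hM _
  calc Real.log M * M ^ (1 - σ) ≤ Real.log N * r ^ (σ - 1) * M ^ (1 - σ) :=
        mul_le_mul_of_nonneg_right key hMpow.le
    _ = Real.log N * N ^ (1 - σ) * (r ^ (σ - 1) * r ^ (1 - σ)) := by rw [hsplit]; ring
    _ = Real.log N * N ^ (1 - σ) := by rw [hrr, mul_one]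

/-- For `L > 0` and `1/L ≤ y₀ ≤ y`: `y e^{−yL} ≤ y₀ e^{−y₀L}` (from `e^{(y−y₀)L} ≥ 1 + (y−y₀)L ≥ y/y₀`).
[folklore] -/
theorem mul_exp_neg_mul_le {L y₀ y : ℝ} (hL : 0 < L) (hy₀ : 1 / L ≤ y₀) (hy : y₀ ≤ y) :
    y * Real.exp (-(y * L)) ≤ y₀ * Real.exp (-(y₀ * L)) := by
  have hy₀pos : 0 < y₀ := lt_of_lt_of_le (by positivity) hy₀
  have hLy₀ : 1 ≤ L * y₀ := by
    rw [div_le_iff₀ hL] at hy₀; linarith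
  -- `y ≤ y₀ e^{(y - y₀) L}`
  have key : y ≤ y₀ * Real.exp ((y - y₀) * L) := by
    have h1 := Real.add_one_le_exp ((y - y₀) * L)
    have h2 : y ≤ y₀ * ((y - y₀) * L + 1) := by nlinarith
    exact h2.trans (mul_le_mul_of_nonneg_left h1 hy₀pos.le)
  have hexp : Real.exp ((y - y₀) * L) = Real.exp (-(y₀ * L)) / Real.exp (-(y * L)) := by
    rw [← Real.exp_sub]; congr 1; ring
  rw [hexp, mul_div_assoc'] at key
  rwa [le_div_iff₀ (Real.exp_pos _)] at key

/-! ## The tail of the zeta series under Theorem 3 (§4 of the source) -/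

/-- Theorem 3 for the twist `n^{-it}` at `x ≥ N`: `|S₁(x)| ≤ C|ζ(s)|(σ−1)((σ−1)^{-4/π} + log x)` when
`3 ≤ N ≤ x`, `1 < σ ≤ 2`, `(σ − 1) log N ≥ 1` (so that `1 + 1/log x ≤ σ`).
[cite: MontgomeryVaughan2001, §4 (p. 212)] -/
theorem norm_S₁_twist_le {C : ℝ}
    (hC : ∀ f : ℕ →*₀ ℂ, (∀ n, ‖f n‖ ≤ 1) → ∀ x : ℝ, 3 ≤ x → ∀ σ : ℝ, 1 + 1 / Real.log x ≤ σ →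
      σ ≤ 2 → ‖S₁ f x‖ ≤ C * ‖LSeries (f ·) σ‖ * (σ - 1) * ((σ - 1) ^ (-(4 / Real.pi)) + Real.log x))
    {N x σ : ℝ} {t : ℝ} (ht : t ≠ 0) (hN : 3 ≤ N) (hNx : N ≤ x)
    (hσ : 1 < σ) (hσ2 : σ ≤ 2) (hlog : 1 ≤ (σ - 1) * Real.log N) :
    ‖S₁ (riemannZetaSummandHom (ofReal_mul_I_ne_zero ht) ·) x‖ ≤ C * ‖riemannZeta (σ + t * I)‖ * (σ - 1) *
      ((σ - 1) ^ (-(4 / Real.pi)) + Real.log x) := by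
  have hlogN : 0 < Real.log N := Real.log_pos (by linarith)
  have hlogx : Real.log N ≤ Real.log x := Real.log_le_log (by linarith) hNx
  have hσx : 1 + 1 / Real.log x ≤ σ := by
    have h1 : 1 / Real.log x ≤ 1 / Real.log N := one_div_le_one_div_of_le hlogN hlogx
    have h2 : 1 / Real.log N ≤ σ - 1 := by
      rw [div_le_iff₀ hlogN]; linarith
    linarith
  have := hC (riemannZetaSummandHom (ofReal_mul_I_ne_zero ht)) (norm_twist_le ht) x (by linarith) σ hσx hσ2
  rwa [LSeries_twist hσ ht] at this

/-- The primitive used for the integral in Abel's formula: for `u > 0`,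
`d/du [u^{1−σ}(A + log u + 1/(σ−1))] = −(σ − 1) u^{−σ} (A + log u)`. [folklore] -/
theorem hasDerivAt_tailPrimitive {σ A u : ℝ} (hσ : 1 < σ) (hu : 0 < u) :
    HasDerivAt (fun u : ℝ ↦ u ^ (1 - σ) * (A + Real.log u + 1 / (σ - 1)))
      (-((σ - 1) * u ^ (-σ) * (A + Real.log u))) u := by
  have h1 : HasDerivAt (fun u : ℝ ↦ u ^ (1 - σ)) ((1 - σ) * u ^ (-σ)) u := by
    have := Real.hasDerivAt_rpow_const (p := 1 - σ) (Or.inl hu.ne')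
    rwa [show (1 : ℝ) - σ - 1 = -σ by ring] at this
  have h2 : HasDerivAt (fun u : ℝ ↦ A + Real.log u + 1 / (σ - 1)) u⁻¹ u :=
    ((Real.hasDerivAt_log hu.ne').const_add A).add_const _
  refine (h1.mul h2).congr_deriv ?_
  have hpow : u ^ (1 - σ) * u⁻¹ = u ^ (-σ) := by
    rw [show -σ = (1 - σ) - 1 by ring, Real.rpow_sub_one hu.ne', div_eq_mul_inv]
  rw [hpow]
  have hσ0 : σ - 1 ≠ 0 := by linarith
  field_simp
  ring

/-- `∫_N^M (σ−1) u^{−σ} K (A + log u) du = K[Ψ(N) − Ψ(M)]`, `Ψ(u) = u^{1−σ}(A + log u + 1/(σ−1))`, for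
`1 ≤ N ≤ M`. [folklore] -/
theorem integral_tail_eq {σ A K N M : ℝ} (hσ : 1 < σ) (hN : 1 ≤ N) (hNM : N ≤ M) :
    ∫ u in N..M, (σ - 1) * u ^ (-σ) * (K * (A + Real.log u)) =
      K * (N ^ (1 - σ) * (A + Real.log N + 1 / (σ - 1))) -
        K * (M ^ (1 - σ) * (A + Real.log M + 1 / (σ - 1))) := by
  have hderiv : ∀ u ∈ Set.uIcc N M, HasDerivAt
      (fun u : ℝ ↦ -K * (u ^ (1 - σ) * (A + Real.log u + 1 / (σ - 1))))
      ((σ - 1) * u ^ (-σ) * (K * (A + Real.log u))) u := by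
    intro u hu
    rw [Set.uIcc_of_le hNM] at hu
    have hu0 : 0 < u := by linarith [hu.1]
    refine ((hasDerivAt_tailPrimitive (A := A) hσ hu0).const_mul (-K)).congr_deriv ?_
    ring
  have hcont : ContinuousOn (fun u : ℝ ↦ (σ - 1) * u ^ (-σ) * (K * (A + Real.log u)))
      (Set.uIcc N M) := by
    rw [Set.uIcc_of_le hNM]
    have hne : ∀ u ∈ Set.Icc N M, u ≠ 0 := fun u hu ↦ by linarith [hu.1]
    apply ContinuousOn.mul
    · exact continuousOn_const.mul (continuousOn_id.rpow_const fun u hu ↦ Or.inl (hne u hu))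
    · exact continuousOn_const.mul
        (continuousOn_const.add (Real.continuousOn_log.mono fun u hu ↦ hne u hu))
  rw [intervalIntegral.integral_eq_sub_of_hasDerivAt hderiv hcont.intervalIntegrable]
  ring

/-- **The tail block under Theorem 3** (§4 of the source, made uniform in `M`): for `3 ≤ N ≤ M`,
`1 < σ ≤ 2`, `(σ − 1) log N ≥ 1`, `s = σ + it`, and Theorem 3 with constant `C ≥ 0`,
`|ζ_M(s) − ζ_N(s)| ≤ 4C |ζ(s)| ((σ−1)^{1−4/π} + (σ−1) log N) N^{1−σ}`. Proof: Abel summation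
`Σ_{N<n≤M} n^{-s} = S₁(M)M^{1−σ} − S₁(N)N^{1−σ} + (σ−1)∫_N^M S₁(u)u^{−σ} du` with `f(n) = n^{-it}`,
`F(σ) = ζ(s)`, and `|S₁(u)| ≤ C|ζ(s)|(σ−1)((σ−1)^{-4/π} + log u)` for `u ≥ N`.
[cite: MontgomeryVaughan2001, §4 (pp. 211–212)] -/
theorem norm_zetaPartialSum_sub_le {C : ℝ}
    (hC : ∀ f : ℕ →*₀ ℂ, (∀ n, ‖f n‖ ≤ 1) → ∀ x : ℝ, 3 ≤ x → ∀ σ : ℝ, 1 + 1 / Real.log x ≤ σ →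
      σ ≤ 2 → ‖S₁ f x‖ ≤ C * ‖LSeries (f ·) σ‖ * (σ - 1) * ((σ - 1) ^ (-(4 / Real.pi)) + Real.log x))
    (hC0 : 0 ≤ C) {N M : ℕ}
    (hN : 3 ≤ N) (hNM : N ≤ M) {σ : ℝ} {t : ℝ} (ht : t ≠ 0) (hσ : 1 < σ) (hσ2 : σ ≤ 2)
    (hlog : 1 ≤ (σ - 1) * Real.log N) :
    ‖zetaPartialSum M (σ + t * I) - zetaPartialSum N (σ + t * I)‖ ≤
      4 * C * ‖riemannZeta (σ + t * I)‖ *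
        (((σ - 1) ^ (1 - 4 / Real.pi) + (σ - 1) * Real.log N) * (N : ℝ) ^ (1 - σ)) := by
  -- notation and positivity
  set F : ℝ := ‖riemannZeta (σ + t * I)‖ with hF
  set A : ℝ := (σ - 1) ^ (-(4 / Real.pi)) with hA
  set K : ℝ := C * F * (σ - 1) with hK
  have hNr : (3 : ℝ) ≤ N := by exact_mod_cast hN
  have hNpos : (0 : ℝ) < N := by linarith
  have hNMr : (N : ℝ) ≤ M := by exact_mod_cast hNM
  have hMpos : (0 : ℝ) < M := by linarith
  have hlogN : 0 < Real.log N := Real.log_pos (by linarith)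
  have hF0 : 0 ≤ F := norm_nonneg _
  have hA0 : 0 < A := Real.rpow_pos_of_pos (by linarith) _
  have hK0 : 0 ≤ K := by rw [hK]; exact mul_nonneg (mul_nonneg hC0 hF0) (by linarith)
  have hinvlog : 1 / (σ - 1) ≤ Real.log N := by
    rw [div_le_iff₀ (by linarith : (0 : ℝ) < σ - 1)]; linarith
  have hNpow : 0 < (N : ℝ) ^ (1 - σ) := Real.rpow_pos_of_pos hNpos _
  -- Theorem 3 for the twist, at real `x ≥ N`
  have hS : ∀ x : ℝ, (N : ℝ) ≤ x → ‖S₁ (riemannZetaSummandHom (ofReal_mul_I_ne_zero ht) ·) x‖ ≤ K * (A + Real.log x) := by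
    intro x hx
    have := norm_S₁_twist_le hC ht hNr hx hσ hσ2 hlog
    rw [hK, hA, hF]
    linarith
  -- the weight `g(u) = u^{1-σ}` and its derivative
  set g : ℝ → ℂ := fun u ↦ ((u ^ (1 - σ) : ℝ) : ℂ) with hg
  have hgd : ∀ u : ℝ, 0 < u → HasDerivAt g ((((1 - σ) * u ^ (-σ) : ℝ)) : ℂ) u := by
    intro u hu
    have := (Real.hasDerivAt_rpow_const (p := 1 - σ) (Or.inl hu.ne')).ofReal_comp
    rw [show (1 : ℝ) - σ - 1 = -σ by ring] at this
    exact this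
  have hg_diff : ∀ u ∈ Set.Icc (N : ℝ) M, DifferentiableAt ℝ g u := fun u hu ↦
    (hgd u (by linarith [hu.1])).differentiableAt
  have hg_deriv : ∀ u : ℝ, 0 < u → deriv g u = (((1 - σ) * u ^ (-σ) : ℝ) : ℂ) := fun u hu ↦
    (hgd u hu).deriv
  have hcont : ContinuousOn (fun u : ℝ ↦ (((1 - σ) * u ^ (-σ) : ℝ) : ℂ)) (Set.Icc (N : ℝ) M) := by
    apply Complex.continuous_ofReal.comp_continuousOn
    apply ContinuousOn.mul continuousOn_const
    exact continuousOn_id.rpow_const fun u hu ↦ Or.inl (by simp only [id]; linarith [hu.1])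
  have hg_int : IntegrableOn (deriv g) (Set.Icc (N : ℝ) M) := by
    refine (hcont.integrableOn_Icc).congr_fun (fun u hu ↦ ?_) measurableSet_Icc
    exact (hg_deriv u (by linarith [hu.1])).symm
  have hgnorm : ∀ u : ℝ, 0 < u → ‖g u‖ = u ^ (1 - σ) := fun u hu ↦ by
    rw [hg]; simp only [Complex.norm_real, Real.norm_eq_abs]
    exact abs_of_pos (Real.rpow_pos_of_pos hu _)
  -- Abel summation
  have habel := sum_mul_eq_sub_sub_integral_mul'
    (fun k ↦ riemannZetaSummandHom (ofReal_mul_I_ne_zero ht) k / k) hNM hg_diff hg_int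
  rw [← zetaPartialSum_sub_eq_sum_Ioc hNM σ ht, sum_Icc_zero_twist_div ht,
    sum_Icc_zero_twist_div ht] at habel
  simp_rw [sum_Icc_zero_twist_div ht] at habel
  rw [habel]
  -- the three terms
  have hT1 : ‖g M * S₁ (riemannZetaSummandHom (ofReal_mul_I_ne_zero ht) ·) M‖ ≤ K * (A + Real.log N) * (N : ℝ) ^ (1 - σ) := by
    rw [norm_mul, hgnorm M hMpos]
    have h1 := hS M hNMr
    have hMN : (M : ℝ) ^ (1 - σ) ≤ (N : ℝ) ^ (1 - σ) :=
      Real.rpow_le_rpow_of_nonpos hNpos hNMr (by linarith)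
    have hlm := log_mul_rpow_le hσ hNpos hNMr hlog
    have hMpow : 0 ≤ (M : ℝ) ^ (1 - σ) := (Real.rpow_pos_of_pos hMpos _).le
    calc (M : ℝ) ^ (1 - σ) * ‖S₁ (riemannZetaSummandHom (ofReal_mul_I_ne_zero ht) ·) M‖
        ≤ (M : ℝ) ^ (1 - σ) * (K * (A + Real.log M)) := mul_le_mul_of_nonneg_left h1 hMpow
      _ = K * (A * (M : ℝ) ^ (1 - σ) + Real.log M * (M : ℝ) ^ (1 - σ)) := by ring
      _ ≤ K * (A * (N : ℝ) ^ (1 - σ) + Real.log N * (N : ℝ) ^ (1 - σ)) := by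
          apply mul_le_mul_of_nonneg_left _ hK0
          exact add_le_add (mul_le_mul_of_nonneg_left hMN hA0.le) hlm
      _ = K * (A + Real.log N) * (N : ℝ) ^ (1 - σ) := by ring
  have hT2 : ‖g N * S₁ (riemannZetaSummandHom (ofReal_mul_I_ne_zero ht) ·) N‖ ≤ K * (A + Real.log N) * (N : ℝ) ^ (1 - σ) := by
    rw [norm_mul, hgnorm N hNpos]
    have h1 := hS N le_rfl
    calc (N : ℝ) ^ (1 - σ) * ‖S₁ (riemannZetaSummandHom (ofReal_mul_I_ne_zero ht) ·) N‖
        ≤ (N : ℝ) ^ (1 - σ) * (K * (A + Real.log N)) := mul_le_mul_of_nonneg_left h1 hNpow.le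
      _ = K * (A + Real.log N) * (N : ℝ) ^ (1 - σ) := by ring
  have hT3 : ‖∫ u in Set.Ioc (N : ℝ) M, deriv g u * S₁ (riemannZetaSummandHom (ofReal_mul_I_ne_zero ht) ·) (⌊u⌋₊ : ℕ)‖ ≤
      K * (A + 2 * Real.log N) * (N : ℝ) ^ (1 - σ) := by
    set bound : ℝ → ℝ := fun u ↦ (σ - 1) * u ^ (-σ) * (K * (A + Real.log u)) with hbound
    have hne : ∀ u ∈ Set.Icc (N : ℝ) M, u ≠ 0 := fun u hu ↦ by linarith [hu.1]
    have hbcont : ContinuousOn bound (Set.Icc (N : ℝ) M) := by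
      apply ContinuousOn.mul
      · exact continuousOn_const.mul (continuousOn_id.rpow_const fun u hu ↦ Or.inl (hne u hu))
      · exact continuousOn_const.mul
          (continuousOn_const.add (Real.continuousOn_log.mono fun u hu ↦ hne u hu))
    have hbint : IntegrableOn bound (Set.Ioc (N : ℝ) M) :=
      (hbcont.integrableOn_Icc).mono_set Set.Ioc_subset_Icc_self
    have hle : ∀ᵐ u ∂(volume.restrict (Set.Ioc (N : ℝ) M)),
        ‖deriv g u * S₁ (riemannZetaSummandHom (ofReal_mul_I_ne_zero ht) ·) (⌊u⌋₊ : ℕ)‖ ≤ bound u := by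
      rw [ae_restrict_iff' measurableSet_Ioc]
      refine Filter.Eventually.of_forall fun u hu ↦ ?_
      have hu0 : 0 < u := by linarith [hu.1]
      have hfloor : S₁ (riemannZetaSummandHom (ofReal_mul_I_ne_zero ht) ·) (⌊u⌋₊ : ℕ) = S₁ (riemannZetaSummandHom (ofReal_mul_I_ne_zero ht) ·) u := by
        rw [S₁_natCast, S₁]
      rw [norm_mul, hg_deriv u hu0, hfloor, Complex.norm_real, Real.norm_eq_abs, abs_mul,
        abs_of_neg (by linarith : 1 - σ < 0), abs_of_pos (Real.rpow_pos_of_pos hu0 _), hbound]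
      have h1 := hS u hu.1.le
      have h2 : 0 ≤ -(1 - σ) * u ^ (-σ) := mul_nonneg (by linarith) (Real.rpow_pos_of_pos hu0 _).le
      calc -(1 - σ) * u ^ (-σ) * ‖S₁ (riemannZetaSummandHom (ofReal_mul_I_ne_zero ht) ·) u‖
          ≤ -(1 - σ) * u ^ (-σ) * (K * (A + Real.log u)) := mul_le_mul_of_nonneg_left h1 h2
        _ = (σ - 1) * u ^ (-σ) * (K * (A + Real.log u)) := by ring
    have hI := norm_integral_le_of_norm_le hbint hle
    have hval : ∫ u in Set.Ioc (N : ℝ) M, bound u =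
        K * ((N : ℝ) ^ (1 - σ) * (A + Real.log N + 1 / (σ - 1))) -
          K * ((M : ℝ) ^ (1 - σ) * (A + Real.log M + 1 / (σ - 1))) := by
      rw [← intervalIntegral.integral_of_le hNMr, hbound]
      exact integral_tail_eq hσ (by linarith) hNMr
    rw [hval] at hI
    have hΨM : 0 ≤ K * ((M : ℝ) ^ (1 - σ) * (A + Real.log M + 1 / (σ - 1))) := by
      apply mul_nonneg hK0 (mul_nonneg (Real.rpow_pos_of_pos hMpos _).le _)
      have : 0 ≤ Real.log M := Real.log_nonneg (by linarith)
      have : 0 ≤ 1 / (σ - 1) := div_nonneg zero_le_one (by linarith)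
      linarith
    calc ‖∫ u in Set.Ioc (N : ℝ) M, deriv g u * S₁ (riemannZetaSummandHom (ofReal_mul_I_ne_zero ht) ·) (⌊u⌋₊ : ℕ)‖
        ≤ K * ((N : ℝ) ^ (1 - σ) * (A + Real.log N + 1 / (σ - 1))) -
          K * ((M : ℝ) ^ (1 - σ) * (A + Real.log M + 1 / (σ - 1))) := hI
      _ ≤ K * ((N : ℝ) ^ (1 - σ) * (A + Real.log N + 1 / (σ - 1))) := by linarith
      _ ≤ K * ((N : ℝ) ^ (1 - σ) * (A + Real.log N + Real.log N)) := by
          apply mul_le_mul_of_nonneg_left _ hK0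
          exact mul_le_mul_of_nonneg_left (by linarith) hNpow.le
      _ = K * (A + 2 * Real.log N) * (N : ℝ) ^ (1 - σ) := by ring
  -- assemble
  have hsum : ‖g M * S₁ (riemannZetaSummandHom (ofReal_mul_I_ne_zero ht) ·) M - g N * S₁ (riemannZetaSummandHom (ofReal_mul_I_ne_zero ht) ·) N -
      ∫ u in Set.Ioc (N : ℝ) M, deriv g u * S₁ (riemannZetaSummandHom (ofReal_mul_I_ne_zero ht) ·) (⌊u⌋₊ : ℕ)‖ ≤
      4 * (K * (A + Real.log N) * (N : ℝ) ^ (1 - σ)) := by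
    refine (norm_sub_le _ _).trans ?_
    refine (add_le_add ((norm_sub_le _ _).trans (add_le_add hT1 hT2)) hT3).trans ?_
    have : 0 ≤ K * A * (N : ℝ) ^ (1 - σ) := by positivity
    nlinarith
  refine hsum.trans (le_of_eq ?_)
  have hsplit : (σ - 1) ^ (1 - 4 / Real.pi) = (σ - 1) * A := by
    rw [hA, show (1 : ℝ) - 4 / Real.pi = 1 + -(4 / Real.pi) by ring,
      Real.rpow_add (by linarith : (0 : ℝ) < σ - 1), Real.rpow_one]
  rw [hsplit, hK]
  ring

/-- **The tail of the zeta series under Theorem 3**: letting `M → ∞` in `norm_zetaPartialSum_sub_le`,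
`|ζ(s) − ζ_N(s)| ≤ 4C|ζ(s)|((σ−1)^{1−4/π} + (σ−1) log N) N^{1−σ}` ("`Σ_{n>N} f(n)n^{-σ} ≪
|F(σ)|(σ−1)((σ−1)^{-4/π} + log N)N^{1−σ}` when `1 + 1/log N ≤ σ ≤ 2`", p. 212).
[cite: MontgomeryVaughan2001, §4 (p. 212)] -/
theorem norm_zeta_sub_zetaPartialSum_le {C : ℝ}
    (hC : ∀ f : ℕ →*₀ ℂ, (∀ n, ‖f n‖ ≤ 1) → ∀ x : ℝ, 3 ≤ x → ∀ σ : ℝ, 1 + 1 / Real.log x ≤ σ →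
      σ ≤ 2 → ‖S₁ f x‖ ≤ C * ‖LSeries (f ·) σ‖ * (σ - 1) * ((σ - 1) ^ (-(4 / Real.pi)) + Real.log x))
    (hC0 : 0 ≤ C) {N : ℕ}
    (hN : 3 ≤ N) {σ : ℝ} {t : ℝ} (ht : t ≠ 0) (hσ : 1 < σ) (hσ2 : σ ≤ 2)
    (hlog : 1 ≤ (σ - 1) * Real.log N) :
    ‖riemannZeta (σ + t * I) - zetaPartialSum N (σ + t * I)‖ ≤
      4 * C * ‖riemannZeta (σ + t * I)‖ *
        (((σ - 1) ^ (1 - 4 / Real.pi) + (σ - 1) * Real.log N) * (N : ℝ) ^ (1 - σ)) := by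
  have hs : 1 < ((σ : ℂ) + t * I).re := by simp [hσ]
  have hlim : Tendsto (fun M : ℕ ↦ ‖zetaPartialSum M (σ + t * I) - zetaPartialSum N (σ + t * I)‖)
      atTop (𝓝 ‖riemannZeta (σ + t * I) - zetaPartialSum N (σ + t * I)‖) :=
    ((tendsto_zetaPartialSum hs).sub_const _).norm
  refine le_of_tendsto hlim ?_
  rw [Filter.eventually_atTop]
  exact ⟨N, fun M hM ↦ norm_zetaPartialSum_sub_le hC hC0 hN hM ht hσ hσ2 hlog⟩

/-! ## The error factor in the half-plane `σ ≥ 1 + (4/π − 1) log log N / log N` -/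

/-- In the half-plane `σ − 1 ≥ κ log log N/log N` (`κ = 4/π − 1`, `κ log log N ≥ 1`):
`((σ−1)^{1−4/π} + (σ−1) log N) N^{1−σ} ≤ (κ log log N)^{−κ} + κ log log N · (log N)^{−κ}` — both
summands are decreasing in `σ` there, and at `σ − 1 = κ log log N/log N` one has
`N^{1−σ} = (log N)^{−κ}`, `(σ−1)^{1−4/π} = (σ−1)^{−κ} = (κ log log N)^{−κ}(log N)^{κ}`. (The source:
"`U_N(s) = ζ(s)(1 + O((log log N)^{1−4/π}))` uniformly for `σ ≥ 1 + (4/π − 1) log log N/log N`".)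
[cite: MontgomeryVaughan2001, §4 (p. 212)] -/
theorem errorFactor_le {σ N : ℝ} (hN : 1 < N)
    (hLL : 1 ≤ (4 / Real.pi - 1) * Real.log (Real.log N))
    (hσ : 1 + (4 / Real.pi - 1) * Real.log (Real.log N) / Real.log N ≤ σ) :
    ((σ - 1) ^ (1 - 4 / Real.pi) + (σ - 1) * Real.log N) * N ^ (1 - σ) ≤
      ((4 / Real.pi - 1) * Real.log (Real.log N)) ^ (-(4 / Real.pi - 1)) +
        (4 / Real.pi - 1) * Real.log (Real.log N) * Real.log N ^ (-(4 / Real.pi - 1)) := by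
  set κ : ℝ := 4 / Real.pi - 1 with hκ
  have hκpos : 0 < κ := by
    rw [hκ, sub_pos, lt_div_iff₀ Real.pi_pos]; linarith [Real.pi_lt_four]
  set L : ℝ := Real.log N with hL
  set LL : ℝ := Real.log L with hLLdef
  have hLpos : 0 < L := Real.log_pos hN
  have hκLL : 0 < κ * LL := lt_of_lt_of_le one_pos hLL
  have hLLpos : 0 < LL := pos_of_mul_pos_right hκLL hκpos.le
  set y₀ : ℝ := κ * LL / L with hy₀
  have hy₀pos : 0 < y₀ := div_pos hκLL hLpos
  have hσy : y₀ ≤ σ - 1 := by rw [hy₀]; linarith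
  have hσ1 : 0 < σ - 1 := lt_of_lt_of_le hy₀pos hσy
  have hNpos : 0 < N := by linarith
  -- `N^{1-σ} ≤ N^{-y₀} = L^{-κ}`
  have hNy₀ : N ^ (-y₀) = L ^ (-κ) := by
    rw [Real.rpow_def_of_pos hNpos, ← hL, show L * -y₀ = LL * -κ by rw [hy₀]; field_simp,
      Real.exp_mul, hLLdef, Real.exp_log hLpos]
  have hN1σ : N ^ (1 - σ) ≤ L ^ (-κ) := by
    rw [← hNy₀]
    exact Real.rpow_le_rpow_of_exponent_le hN.le (by linarith)
  have hNpow0 : 0 ≤ N ^ (1 - σ) := (Real.rpow_pos_of_pos hNpos _).le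
  have hLκ : 0 < L ^ (-κ) := Real.rpow_pos_of_pos hLpos _
  -- first summand
  have h1 : (σ - 1) ^ (1 - 4 / Real.pi) * N ^ (1 - σ) ≤ (κ * LL) ^ (-κ) := by
    have hexp : (1 : ℝ) - 4 / Real.pi = -κ := by rw [hκ]; ring
    rw [hexp]
    have hy : (σ - 1) ^ (-κ) ≤ y₀ ^ (-κ) := Real.rpow_le_rpow_of_nonpos hy₀pos hσy (by linarith)
    have hy₀κ : y₀ ^ (-κ) * L ^ (-κ) = (κ * LL) ^ (-κ) := by
      rw [hy₀, Real.div_rpow hκLL.le hLpos.le, div_mul_cancel₀ _ hLκ.ne']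
    calc (σ - 1) ^ (-κ) * N ^ (1 - σ) ≤ y₀ ^ (-κ) * L ^ (-κ) :=
          mul_le_mul hy hN1σ hNpow0 (Real.rpow_pos_of_pos hy₀pos _).le
      _ = (κ * LL) ^ (-κ) := hy₀κ
  -- second summand
  have h2 : (σ - 1) * Real.log N * N ^ (1 - σ) ≤ κ * LL * L ^ (-κ) := by
    have hNexp : N ^ (1 - σ) = Real.exp (-((σ - 1) * L)) := by
      rw [Real.rpow_def_of_pos hNpos, ← hL]; congr 1; ring
    have hy₀L : 1 / L ≤ y₀ := by
      rw [hy₀, div_le_div_iff_of_pos_right hLpos]; exact hLL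
    have key := mul_exp_neg_mul_le hLpos hy₀L hσy
    have hy₀exp : y₀ * Real.exp (-(y₀ * L)) = y₀ * L ^ (-κ) := by
      rw [show y₀ * L = LL * κ by rw [hy₀]; field_simp, show -(LL * κ) = LL * -κ by ring,
        Real.exp_mul, hLLdef, Real.exp_log hLpos]
    rw [hy₀exp] at key
    rw [← hL, hNexp]
    calc (σ - 1) * L * Real.exp (-((σ - 1) * L)) = L * ((σ - 1) * Real.exp (-((σ - 1) * L))) := by
          ring
      _ ≤ L * (y₀ * L ^ (-κ)) := mul_le_mul_of_nonneg_left key hLpos.le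
      _ = κ * LL * L ^ (-κ) := by rw [hy₀]; field_simp
  calc ((σ - 1) ^ (1 - 4 / Real.pi) + (σ - 1) * Real.log N) * N ^ (1 - σ)
      = (σ - 1) ^ (1 - 4 / Real.pi) * N ^ (1 - σ) + (σ - 1) * Real.log N * N ^ (1 - σ) := by ring
    _ ≤ (κ * LL) ^ (-κ) + κ * LL * L ^ (-κ) := add_le_add h1 h2

/-- The majorant `(κ log log N)^{−κ} + κ log log N (log N)^{−κ}` tends to `0` (`κ = 4/π − 1 > 0`).
[folklore] -/
theorem tendsto_errorBound :
    Tendsto (fun N : ℕ ↦ ((4 / Real.pi - 1) * Real.log (Real.log N)) ^ (-(4 / Real.pi - 1)) +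
        (4 / Real.pi - 1) * Real.log (Real.log N) * Real.log N ^ (-(4 / Real.pi - 1)))
      atTop (𝓝 0) := by
  set κ : ℝ := 4 / Real.pi - 1 with hκ
  have hκpos : 0 < κ := by
    rw [hκ, sub_pos, lt_div_iff₀ Real.pi_pos]; linarith [Real.pi_lt_four]
  have hL : Tendsto (fun N : ℕ ↦ Real.log N) atTop atTop :=
    Real.tendsto_log_atTop.comp tendsto_natCast_atTop_atTop
  have hLL : Tendsto (fun N : ℕ ↦ Real.log (Real.log N)) atTop atTop :=
    Real.tendsto_log_atTop.comp hL
  have T1 : Tendsto (fun N : ℕ ↦ (κ * Real.log (Real.log N)) ^ (-κ)) atTop (𝓝 0) :=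
    (tendsto_rpow_neg_atTop hκpos).comp (hLL.const_mul_atTop hκpos)
  have T2' : Tendsto (fun N : ℕ ↦ Real.log (Real.log N) / Real.log N ^ κ) atTop (𝓝 0) :=
    ((isLittleO_log_rpow_atTop hκpos).tendsto_div_nhds_zero).comp hL
  have T2 : Tendsto (fun N : ℕ ↦ κ * Real.log (Real.log N) * Real.log N ^ (-κ)) atTop (𝓝 0) := by
    have := T2'.const_mul κ
    rw [mul_zero] at this
    refine this.congr fun N ↦ ?_
    rw [Real.rpow_neg (Real.log_natCast_nonneg N), div_eq_mul_inv, mul_assoc]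
  simpa using T1.add T2

/-! ## Theorem 3 ⇒ Theorem 4 -/

/-- **Montgomery–Vaughan 2001, Theorem 4 from Theorem 3** (§4 of the source): granted Theorem 3
(`Literature.NumberTheory.LFunctions.MontgomeryVaughan2001_thm3`), there is `N₀` such that for `N > N₀`
the section `ζ_N(s) = Σ_{n ≤ N} n^{-s}` has no zero in the half-plane
`σ ≥ 1 + (4/π − 1) log log N/log N` (`MontgomeryVaughan2001_zeroFree`). Proof as printed: with
`f(n) = n^{-it}`, `ζ_N(s) = ζ(s) − Σ_{n>N} n^{-s}` and the tail is
`≪ |ζ(s)|((σ−1)^{1−4/π} + (σ−1) log N)N^{1−σ} = |ζ(s)| · o(1)` uniformly in that half-plane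
(`norm_zeta_sub_zetaPartialSum_le`, `errorFactor_le`, `tendsto_errorBound`), while `ζ(s) ≠ 0` for
`σ > 1`; for `σ ≥ 2` directly `zetaPartialSum_ne_zero_of_two_le_re`.
[cite: MontgomeryVaughan2001, Theorem 4 and §4] -/
theorem MontgomeryVaughan2001_zeroFree_of_thm3 (h : MontgomeryVaughan2001_thm3) :
    MontgomeryVaughan2001_zeroFree := by
  obtain ⟨C, hC0, hC⟩ := h
  set κ : ℝ := 4 / Real.pi - 1 with hκ
  have hκpos : 0 < κ := by
    rw [hκ, sub_pos, lt_div_iff₀ Real.pi_pos]; linarith [Real.pi_lt_four]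
  -- choose `N₀`
  have hδ : (0 : ℝ) < 1 / (4 * C + 1) := by positivity
  have e1 := tendsto_errorBound.eventually_lt_const hδ
  have hLL : Tendsto (fun N : ℕ ↦ Real.log (Real.log N)) atTop atTop :=
    Real.tendsto_log_atTop.comp (Real.tendsto_log_atTop.comp tendsto_natCast_atTop_atTop)
  have e2 : ∀ᶠ N : ℕ in atTop, 1 ≤ κ * Real.log (Real.log N) :=
    (hLL.const_mul_atTop hκpos).eventually_ge_atTop 1
  have e3 : ∀ᶠ N : ℕ in atTop, 16 ≤ N := eventually_ge_atTop 16
  obtain ⟨N₀, hN₀⟩ := Filter.eventually_atTop.1 (e1.and (e2.and e3))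
  refine ⟨N₀, fun N hN s hs ↦ ?_⟩
  obtain ⟨hE, hLLN, h16⟩ := hN₀ N hN.le
  -- the trivial range `σ ≥ 2`
  rcases le_or_gt 2 s.re with h2 | h2
  · exact zetaPartialSum_ne_zero_of_two_le_re (by omega) h2
  -- real `s`
  rcases eq_or_ne s.im 0 with him | ht
  · have hs_real : s = (s.re : ℂ) := by
      apply Complex.ext <;> simp [him]
    rw [hs_real]
    exact zetaPartialSum_ofReal_ne_zero (by omega) s.re
  -- `s = σ + it` with `1 < σ < 2`, `t ≠ 0`, `(σ - 1) log N ≥ κ log log N ≥ 1`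
  have hs_eq : (s.re : ℂ) + s.im * I = s := Complex.re_add_im s
  have hNr : (1 : ℝ) < N := by exact_mod_cast (show 1 < N by omega)
  have hLpos : 0 < Real.log N := Real.log_pos hNr
  have hy₀ : 0 < κ * Real.log (Real.log N) / Real.log N := div_pos (by linarith) hLpos
  have hσ1 : 1 < s.re := by rw [hκ] at hy₀; linarith
  have hlog : 1 ≤ (s.re - 1) * Real.log N := by
    have : κ * Real.log (Real.log N) / Real.log N ≤ s.re - 1 := by rw [hκ]; linarith
    rw [div_le_iff₀ hLpos] at this
    linarith
  have htail := norm_zeta_sub_zetaPartialSum_le hC hC0.le (N := N) (by omega) ht hσ1 h2.le hlog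
  have hEσ := errorFactor_le hNr hLLN hs
  rw [hs_eq] at htail
  intro h0
  rw [h0, sub_zero] at htail
  have hζ : riemannZeta s ≠ 0 := riemannZeta_ne_zero_of_one_lt_re hσ1
  have hζpos : 0 < ‖riemannZeta s‖ := norm_pos_iff.2 hζ
  -- `‖ζ(s)‖ ≤ 4C‖ζ(s)‖ E ≤ 4C ‖ζ(s)‖ E₀ < ‖ζ(s)‖`
  set E₀ : ℝ := (κ * Real.log (Real.log N)) ^ (-κ) +
    κ * Real.log (Real.log N) * Real.log N ^ (-κ) with hE₀
  have hE₀nonneg : 0 ≤ E₀ := by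
    have : 0 ≤ Real.log (Real.log N) :=
      (pos_of_mul_pos_right (lt_of_lt_of_le one_pos hLLN) hκpos.le).le
    positivity
  have h4C : 4 * C * E₀ < 1 := by
    have h1 : 4 * C * E₀ ≤ (4 * C + 1) * E₀ := by nlinarith
    have h2 : (4 * C + 1) * E₀ < 1 := by
      have := hE
      rw [lt_div_iff₀ (by positivity : (0 : ℝ) < 4 * C + 1)] at this
      linarith
    linarith
  have hle : ‖riemannZeta s‖ ≤ 4 * C * ‖riemannZeta s‖ * E₀ :=
    htail.trans (mul_le_mul_of_nonneg_left hEσ (by positivity))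
  nlinarith

/-- **The two-sided `montgomery1983_supZeroRe` from the two deeper inputs, one of them now reduced:**
Montgomery's 1983 theorem (`Montgomery1983_theorem`, named fact) and Montgomery–Vaughan's Theorem 3
(`MontgomeryVaughan2001_thm3`, named fact) give `montgomery1983_supZeroRe`.
[cite: MontgomeryVaughan2001, Theorem 4] [cite: Montgomery1983, §1, Theorem (p. 497)] -/
theorem supZeroRe_of_montgomery_of_thm3 (h1 : Montgomery1983_theorem)
    (h3 : MontgomeryVaughan2001_thm3) : montgomery1983_supZeroRe :=
  supZeroRe_of_montgomery_of_montgomeryVaughan h1 (MontgomeryVaughan2001_zeroFree_of_thm3 h3)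

/-- Likewise the threshold rate hypothesis `TuranHypothesisRate ((4/π − 1) log log N/log N)` holds
granted Theorem 3. [cite: MontgomeryVaughan2001, Theorem 4] -/
theorem TuranHypothesisRate_of_thm3 (h3 : MontgomeryVaughan2001_thm3) :
    TuranHypothesisRate (fun N ↦ (4 / Real.pi - 1) * Real.log (Real.log N) / Real.log N) :=
  TuranHypothesisRate_of_montgomeryVaughan (MontgomeryVaughan2001_zeroFree_of_thm3 h3)

end Literature.Barriers.RiemannHypothesis
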